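import Summits.QuantumFields.YangMills.Theses.MirrorModularBoosts
import Literature.MathematicalPhysics.QuantumFieldTheory.LatticeGaugeProofs

/-!
# `CurvatureBoostCovariance` — negative-side support IV: resampling one product coordinate; a torus-minimal site

First file of the `β ≡ 0` COLLAPSE for crux `stmt-QuantumFields-9663` (standing disprover; work file
`Cruxes/CurvatureBoostCovariance/Disproof.lean` §6). Pure measure theory / combinatorics on the tree's objects.

* `map_update_pi_prod`, `integral_pi_eq_integral_update`: the one-coordinate update map pushes
  `μ₀^{⊗ι} ⊗ μ₀` to `μ₀^{⊗ι}` (probability `μ₀`, finite `ι`); Bochner resampling of one coordinate.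
* `integral_centred_private_eq_zero`: under a right-invariant probability, a factor `f(U i₀ · h U) − ∫f` whose
  partner factors do not see the coordinate `i₀` integrates to zero.
* `exists_torusMinimal`: among fewer than `S` sites of `ℤ⁴` there is one that no site of the family touches from
  below on the torus `(ℤ/S)⁴` (per-coordinate missing residues give wrap-free heights; minimise the total height);
  `proj_injOn_box`.
-/

noncomputable section

open MeasureTheory Filter Topology
open Literature.Probability.LatticeModels (Torus.proj box)
open Literature.MathematicalPhysics.AQFT Literature.MathematicalPhysics.QuantumLattice
open Literature.MathematicalPhysics.QuantumFieldTheory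

namespace Summit.QuantumFields.YangMills.Theorems.CurvatureBoostCovariance.Negative



section Resample

variable {ι X : Type*} [Fintype ι] [DecidableEq ι] [MeasurableSpace X]

omit [Fintype ι] [MeasurableSpace X] in
/-- Preimage of a box under the one-coordinate update map `(U, g) ↦ U[i₀ ↦ g]`. -/
theorem update_preimage_univ_pi_prod (i₀ : ι) (s : ι → Set X) :
    (fun p : (ι → X) × X => Function.update p.1 i₀ p.2) ⁻¹' Set.pi Set.univ s =
      (Set.pi Set.univ (Function.update s i₀ Set.univ)) ×ˢ s i₀ := by
  ext ⟨U, g⟩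
  simp only [Set.mem_preimage, Set.mem_prod, Set.mem_univ_pi]
  constructor
  · intro H
    refine ⟨fun j => ?_, by simpa using H i₀⟩
    by_cases hj : j = i₀
    · subst hj; simp
    · simpa [Function.update_of_ne hj] using H j
  · rintro ⟨H1, H2⟩ j
    by_cases hj : j = i₀
    · subst hj; simpa using H2
    · simpa [Function.update_of_ne hj] using H1 j

/-- **The one-coordinate update map pushes `μ₀^{⊗ι} ⊗ μ₀` forward to `μ₀^{⊗ι}`** (`μ₀` a
probability measure). -/
theorem map_update_pi_prod (μ₀ : Measure X) [IsProbabilityMeasure μ₀] (i₀ : ι) :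
    Measure.map (fun p : (ι → X) × X => Function.update p.1 i₀ p.2)
        ((Measure.pi fun _ : ι => μ₀).prod μ₀) = Measure.pi fun _ : ι => μ₀ := by
  symm
  refine Measure.pi_eq fun s hs => ?_
  rw [Measure.map_apply measurable_update' (MeasurableSet.univ_pi hs),
    update_preimage_univ_pi_prod, Measure.prod_prod, Measure.pi_pi]
  have happ : (fun j => μ₀ (Function.update s i₀ Set.univ j)) =
      Function.update (fun j => μ₀ (s j)) i₀ (μ₀ Set.univ) := by
    funext j
    exact Function.apply_update (fun _ t => μ₀ t) s i₀ Set.univ j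
  rw [happ, Finset.prod_update_of_mem (Finset.mem_univ i₀), measure_univ, one_mul,
    Finset.prod_eq_prod_sdiff_singleton_mul (Finset.mem_univ i₀) fun j => μ₀ (s j)]

/-- **Resampling one coordinate**: for an integrable `F` on the finite product of copies of a
probability measure `μ₀`, `∫ F = ∫ (∫ F(U[i₀ ↦ g]) dμ₀(g)) dμ₀^{⊗ι}(U)`. -/
theorem integral_pi_eq_integral_update (μ₀ : Measure X) [IsProbabilityMeasure μ₀] (i₀ : ι)
    {F : (ι → X) → ℝ} (hF : Integrable F (Measure.pi fun _ : ι => μ₀)) :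
    ∫ U, F U ∂(Measure.pi fun _ : ι => μ₀) =
      ∫ U, (∫ g, F (Function.update U i₀ g) ∂μ₀) ∂(Measure.pi fun _ : ι => μ₀) := by
  have hΦ : AEMeasurable (fun p : (ι → X) × X => Function.update p.1 i₀ p.2)
      ((Measure.pi fun _ : ι => μ₀).prod μ₀) := measurable_update'.aemeasurable
  have hFm : AEStronglyMeasurable F (Measure.map (fun p : (ι → X) × X => Function.update p.1 i₀ p.2)
      ((Measure.pi fun _ : ι => μ₀).prod μ₀)) := by
    rw [map_update_pi_prod]; exact hF.aestronglyMeasurable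
  have hI : Integrable (fun p : (ι → X) × X => F (Function.update p.1 i₀ p.2))
      ((Measure.pi fun _ : ι => μ₀).prod μ₀) := by
    have h := (integrable_map_measure hFm hΦ).1 (by rw [map_update_pi_prod]; exact hF)
    exact h
  calc ∫ U, F U ∂(Measure.pi fun _ : ι => μ₀)
      = ∫ U, F U ∂(Measure.map (fun p : (ι → X) × X => Function.update p.1 i₀ p.2)
          ((Measure.pi fun _ : ι => μ₀).prod μ₀)) := by rw [map_update_pi_prod]
    _ = ∫ p, F (Function.update p.1 i₀ p.2) ∂((Measure.pi fun _ : ι => μ₀).prod μ₀) :=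
          integral_map hΦ hFm
    _ = ∫ U, (∫ g, F (Function.update U i₀ g) ∂μ₀) ∂(Measure.pi fun _ : ι => μ₀) :=
          integral_prod _ hI

end Resample

section Averaging

variable {ι G : Type*} [Fintype ι] [DecidableEq ι] [Group G] [MeasurableSpace G]
  [MeasurableMul₂ G]

/-- **One private coordinate kills a centred factor**: if `h U` and `Ψ U` do not depend on the
coordinate `i₀`, `μ₀` is a right-invariant probability and `f` is bounded measurable, then
`∫ (f (U i₀ * h U) - ∫ f dμ₀) Ψ U dμ₀^{⊗ι} = 0`. -/
theorem integral_centred_private_eq_zero (μ₀ : Measure G) [IsProbabilityMeasure μ₀]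
    [μ₀.IsMulRightInvariant] (i₀ : ι) {f : G → ℝ} (hf : Measurable f) {Cf : ℝ}
    (hfb : ∀ g, |f g| ≤ Cf) {h : (ι → G) → G} (hh : ∀ U g, h (Function.update U i₀ g) = h U)
    (hhm : Measurable h) {Ψ : (ι → G) → ℝ} (hΨ : ∀ U g, Ψ (Function.update U i₀ g) = Ψ U)
    (hΨm : Measurable Ψ) {CΨ : ℝ} (hΨb : ∀ U, |Ψ U| ≤ CΨ) :
    ∫ U, (f (U i₀ * h U) - ∫ g, f g ∂μ₀) * Ψ U ∂(Measure.pi fun _ : ι => μ₀) = 0 := by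
  have hFm : Measurable fun U : ι → G => (f (U i₀ * h U) - ∫ g, f g ∂μ₀) * Ψ U :=
    ((hf.comp ((measurable_pi_apply i₀).mul hhm)).sub measurable_const).mul hΨm
  have hCf : 0 ≤ Cf := (abs_nonneg _).trans (hfb 1)
  have hFi : Integrable (fun U : ι → G => (f (U i₀ * h U) - ∫ g, f g ∂μ₀) * Ψ U)
      (Measure.pi fun _ : ι => μ₀) := by
    refine Integrable.of_bound hFm.aestronglyMeasurable ((Cf + |∫ g, f g ∂μ₀|) * CΨ)
      (ae_of_all _ fun U => ?_)
    rw [Real.norm_eq_abs, abs_mul]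
    have h1 : |f (U i₀ * h U) - ∫ g, f g ∂μ₀| ≤ Cf + |∫ g, f g ∂μ₀| :=
      (abs_sub _ _).trans (add_le_add (hfb _) le_rfl)
    exact mul_le_mul h1 (hΨb U) (abs_nonneg _) (by positivity)
  rw [integral_pi_eq_integral_update μ₀ i₀ hFi]
  refine integral_eq_zero_of_ae (ae_of_all _ fun U => ?_)
  simp only [Function.update_self, hh, hΨ, Pi.zero_apply]
  have hfi : Integrable (fun g => f (g * h U)) μ₀ :=
    Integrable.of_bound (hf.comp (measurable_id.mul_const _)).aestronglyMeasurable Cf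
      (ae_of_all _ fun g => by rw [Real.norm_eq_abs]; exact hfb _)
  have hint : ∫ g, (f (g * h U) - ∫ g, f g ∂μ₀) * Ψ U ∂μ₀ =
      ((∫ g, f (g * h U) ∂μ₀) - ∫ g, f g ∂μ₀) * Ψ U := by
    rw [integral_mul_const, integral_sub hfi (integrable_const _), integral_const, probReal_univ,
      one_smul]
  rw [hint, integral_mul_right_eq_self f (h U), sub_self, zero_mul]

end Averaging



section TorusMinimal

variable {S : ℕ} [NeZero S]

/-- Pigeonhole per coordinate: fewer than `S` sites miss some residue class in each coordinate. -/
theorem exists_missing_residue (B : Finset (Fin 4 → ℤ)) (hcard : B.card < S) (i : Fin 4) :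
    ∃ c : ZMod S, ∀ y ∈ B, ((y i : ℤ) : ZMod S) ≠ c := by
  by_contra h
  push Not at h
  have hsub : (Finset.univ : Finset (ZMod S)) ⊆ B.image fun y => ((y i : ℤ) : ZMod S) := by
    intro c _
    obtain ⟨y, hy, hyc⟩ := h c
    exact Finset.mem_image.2 ⟨y, hy, hyc⟩
  have h1 : S ≤ (B.image fun y => ((y i : ℤ) : ZMod S)).card := by
    simpa [ZMod.card] using Finset.card_le_card hsub
  have h2 := Finset.card_image_le (s := B) (f := fun y => ((y i : ℤ) : ZMod S))
  omega

/-- The height of a residue above the class following the missing class `c`. -/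
def hgt (c : ZMod S) (z : ZMod S) : ℕ := (z - c - 1).val

omit [NeZero S] in
/-- Heights are `< S`. -/
theorem hgt_lt [NeZero S] (c z : ZMod S) : hgt c z < S := ZMod.val_lt _

/-- A residue different from the missing class has height `≤ S - 2`. -/
theorem hgt_le_of_ne {c z : ZMod S} (hz : z ≠ c) : hgt c z ≤ S - 2 := by
  have hlt := hgt_lt c z
  have hne : hgt c z ≠ S - 1 := by
    intro h
    apply hz
    have h' : (z - c - 1 : ZMod S) = ((S - 1 : ℕ) : ZMod S) := by
      rw [← h]; exact (ZMod.natCast_zmod_val _).symm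
    have hS : ((S - 1 : ℕ) : ZMod S) = -1 := by
      have h1 : 1 ≤ S := Nat.one_le_iff_ne_zero.2 (NeZero.ne S)
      rw [Nat.cast_sub h1, Nat.cast_one, ZMod.natCast_self, zero_sub]
    rw [hS] at h'
    linear_combination h'
  omega

omit [NeZero S] in
/-- Below the top, the height of `z + 1` is the height of `z` plus one (no wrap). -/
theorem hgt_add_one [NeZero S] {c z : ZMod S} (hz : hgt c z ≤ S - 2) (hS : 2 ≤ S) :
    hgt c (z + 1) = hgt c z + 1 := by
  unfold hgt at *
  have h1 : (1 : ZMod S).val = 1 := ZMod.val_one'' (by omega)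
  rw [show z + 1 - c - 1 = (z - c - 1) + 1 by ring, ZMod.val_add_of_lt, h1]
  rw [h1]; omega

/-- Total height of a site w.r.t. the missing classes `c`. -/
def totalHgt (c : Fin 4 → ZMod S) (y : Fin 4 → ℤ) : ℕ := ∑ i, hgt (c i) ((y i : ℤ) : ZMod S)

/-- **A torus-minimal base point.** Among fewer than `S` sites of `ℤ⁴` there is one, `y₀`, that no
other site of the family (nor `y₀` itself) touches FROM BELOW on the torus `(ℤ/S)⁴`: if
`y₀ ≡ y' + ε (mod S)` with `ε ∈ {0,1}⁴` and `y'` in the family, then `ε = 0`. -/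
theorem exists_torusMinimal (B : Finset (Fin 4 → ℤ)) (hB : B.Nonempty) (hcard : B.card < S) :
    ∃ y₀ ∈ B, ∀ y' ∈ B, ∀ ε : Fin 4 → ℤ, (∀ i, ε i = 0 ∨ ε i = 1) →
      Torus.proj S y₀ = Torus.proj S (y' + ε) → ε = 0 := by
  classical
  have hS2 : 2 ≤ S := by
    have := hB.card_pos; omega
  choose c hc using fun i => exists_missing_residue B hcard i
  obtain ⟨y₀, hy₀, hmin⟩ := B.exists_min_image (totalHgt c) hB
  refine ⟨y₀, hy₀, fun y' hy' ε hε hproj => ?_⟩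
  -- heights of `y' + ε` coordinatewise
  have hcoord : ∀ i, hgt (c i) (((y' + ε) i : ℤ) : ZMod S) = hgt (c i) ((y' i : ℤ) : ZMod S) +
      (ε i).toNat := by
    intro i
    have hle : hgt (c i) ((y' i : ℤ) : ZMod S) ≤ S - 2 := hgt_le_of_ne (hc i y' hy')
    rcases hε i with h0 | h1
    · simp [h0]
    · rw [Pi.add_apply, h1, Int.cast_add, Int.cast_one, hgt_add_one hle hS2]
      simp
  have hy₀eq : ∀ i, ((y₀ i : ℤ) : ZMod S) = (((y' + ε) i : ℤ) : ZMod S) := fun i => by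
    have := congrFun hproj i
    simpa [Torus.proj] using this
  have hsum : totalHgt c y₀ = totalHgt c y' + ∑ i, (ε i).toNat := by
    unfold totalHgt
    rw [← Finset.sum_add_distrib]
    exact Finset.sum_congr rfl fun i _ => by rw [hy₀eq i, hcoord i]
  have hle := hmin y' hy'
  have hzero : ∑ i, (ε i).toNat = 0 := by omega
  have hall := (Finset.sum_eq_zero_iff_of_nonneg fun i _ => Nat.zero_le _).1 hzero
  funext i
  rcases hε i with h0 | h1
  · exact h0
  · have := hall i (Finset.mem_univ i)
    rw [h1] at this
    simp at this

/-- `Torus.proj (2L+1)` is injective on the box `[-L, L]⁴`. -/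
theorem proj_injOn_box (L : ℕ) {y y' : Fin 4 → ℤ} (hy : y ∈ box 4 L) (hy' : y' ∈ box 4 L)
    (h : Torus.proj (2 * L + 1) y = Torus.proj (2 * L + 1) y') : y = y' := by
  rw [Literature.Probability.LatticeModels.mem_box] at hy hy'
  funext i
  have hi : ((y i : ℤ) : ZMod (2 * L + 1)) = ((y' i : ℤ) : ZMod (2 * L + 1)) := by
    have := congrFun h i
    simpa [Torus.proj] using this
  have hdvd := (ZMod.intCast_eq_intCast_iff_dvd_sub _ _ _).1 hi
  obtain ⟨lo, hi1⟩ := hy i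
  obtain ⟨lo', hi'⟩ := hy' i
  have hlt : |y' i - y i| < ((2 * L + 1 : ℕ) : ℤ) := by
    rw [abs_lt]; push_cast; constructor <;> omega
  have h0 := Int.eq_zero_of_abs_lt_dvd hdvd hlt
  omega

end TorusMinimal



end Summit.QuantumFields.YangMills.Theorems.CurvatureBoostCovariance.Negative

end
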